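import Summits.AtomisticToContinuum.HydrodynamicLimit.Theorems.ImplosionDichotomyDiluteSelfConsistencyPreSingular

/-!
# `ImplosionDichotomy.EosContinuity` — closing file (stmt-AtomisticToContinuum-12589)

Route `ImplosionDichotomy`, support item stmt-AtomisticToContinuum-12589 (`EosContinuity`: continuous dependence of
classical hard-sphere Euler solutions on the reduced diameter at the ideal-gas end, with existence — given an ideal
development on `[0, T₁)` of the reference data, for every `0 < T₂ < T₁` and `ε > 0` a threshold `σ₀` below which
(i) an admissible classical σ-solution exists beyond `T₂` and (ii) every admissible classical σ-solution is ε-close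
to the ideal density on `[0, T₂]`).

The item's unconditional proof is ALREADY in the tree: `eosContinuity_holds`
(`ImplosionDichotomyDiluteSelfConsistencyPreSingular.lean`, lead c3 of the sibling crux stmt-3091, p150709: the
conditional closer `eosContinuity_proof` fed with the discharged named fact `hsEuler_continuousDependence_holds`,
Kato 1975 Thm III for the hard-sphere family). That file was landed as a helper of stmt-3091, so the ledger item
stayed open; this file is the closing proposal naming the item (the CLI `workitem close` verb does not return on this
hub — reported by leads c4/c5 of stmt-3091). Axioms `propext`, `Classical.choice`, `Quot.sound`.

prover-line-stmt-AtomisticToContinuum-3091-c5-0 (route hygiene while leading the sibling crux stmt-3091).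
-/

noncomputable section

namespace Summit.AtomisticToContinuum.HydrodynamicLimit.Theorems

/-- **`EosContinuity` (stmt-AtomisticToContinuum-12589) holds** — the tree theorem `eosContinuity_holds`, restated
against the route decl by name so that the item closes. [cite: Kato1975, Thm III] [cite: Majda1984, Ch. 2 Thm 2.2] -/
theorem eosContinuity_closes :
    Summit.AtomisticToContinuum.HydrodynamicLimit.Theses.ImplosionDichotomy.EosContinuity :=
  eosContinuity_holds

end Summit.AtomisticToContinuum.HydrodynamicLimit.Theorems

end
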